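import Literature.NumberTheory.EllipticCurves.SupersingularInertiaShapeProofs
import HarnessLib

/-!
# Two embeddings of the field with `p²` elements into a field differ by a power of Frobenius

Route `SignedLowerHalves`, child L `SmallImageLowerHalfBothSigns` (item stmt-BirchSwinnertonDyer-23599), line
proposal `rtt_w3`, stub K0₂@p `stub_heckeThetaPartner_ns` — brick S7a (pure algebra) of the arithmetic half at an
ODD prime (width seat `bsd-line-slh-p3-w3` gen 9; memo `Lines/birth_acns-MEMO-w3-g9.md`).  THEOREMS ONLY (no
definition, no named fact, no `sorry`); ROUTE-INDEPENDENT.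

The MATCHING CONDITION `hM` of the Teichmüller twist (`…TeichmullerTwist.exists_isGrossencharakter_congr`) at the
inert prime `𝔭` of the dihedral field `K` compares two ring homomorphisms `𝓞_K/𝔭 ≅ 𝔽_{p²} → k̄_p`:
`b ↦ (η_𝔭(b)⁻¹ read in k̄_p) = ι(b̄)` (brick ORIENT-CFT, `exists_heckeCharacter_localComponent_eq`) and
`b ↦ e⁻¹(σ(b)) mod 𝔪` (the type of the Größencharakter).  Two such embeddings agree up to Frobenius, and
replacing `σ` by its complex conjugate composes the second with Frobenius — so one of the two embeddings
`σ, σ̄ : K → ℂ` satisfies the matching condition.  This file proves the algebra: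

* `ringHom_eq_or_eq_frobenius_of_card_eq_sq` — for a field `k₀` with `p²` elements and a field `L`, two ring
  homomorphisms `κ₁ κ₂ : k₀ → L` satisfy `κ₂ = κ₁` or `κ₂ x = (κ₁ x)^p` for all `x`.

Proof: a generator `g` of `k₀ˣ` has `g ≠ g^p`; `s = g + g^p`, `n = g^{p+1}` lie in the prime field, so
`κ₁ g`, `(κ₁ g)^p` and `κ₂ g` are roots of the same quadratic `X² − s'X + n'` over `L`, whence
`κ₂ g ∈ {κ₁ g, (κ₁ g)^p}`; powers of `g` exhaust `k₀ˣ`.  BSD, crux L and the stub are NOT proved here.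

References: folklore (Galois theory of finite fields: `Gal(𝔽_{p²}/𝔽_p) = ⟨Frob⟩`).
-/

set_option autoImplicit false
set_option linter.dupNamespace false

namespace Summit.BirchSwinnertonDyer.BirchSwinnertonDyer.Theorems.SmallImageLambdaLowerThreeNsThetaPartner

open Literature.NumberTheory.EllipticCurves

/-- **Embeddings of `𝔽_{p²}` differ by a power of Frobenius.**  Let `k₀` be a field with `p²` elements, `L` a
field and `κ₁ κ₂ : k₀ →+* L`.  Then either `κ₂ = κ₁` or `κ₂ x = (κ₁ x) ^ p` for every `x`. [folklore] -/
theorem ringHom_eq_or_eq_frobenius_of_card_eq_sq {p : ℕ} [hp : Fact p.Prime] {k₀ : Type*} [Field k₀]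
    [Fintype k₀] (hcard : Fintype.card k₀ = p ^ 2) {L : Type*} [Field L] (κ₁ κ₂ : k₀ →+* L) :
    κ₂ = κ₁ ∨ ∀ x : k₀, κ₂ x = κ₁ x ^ p := by
  classical
  have hp1 : 1 < p := hp.out.one_lt
  -- characteristic `p`
  haveI : CharP k₀ p := by
    obtain ⟨ℓ, hℓ, n, hℓp, hn⟩ := FiniteField.card' k₀
    have hℓeq : ℓ = p := by
      have h1 : ℓ ∣ p ^ 2 := by rw [← hcard, hn]; exact dvd_pow_self ℓ (PNat.ne_zero n)
      exact (Nat.prime_dvd_prime_iff_eq hℓp hp.out).mp (hℓp.dvd_of_dvd_pow h1)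
    exact hℓeq ▸ hℓ
  haveI : CharP L p := (κ₁.charP_iff_charP p).mp inferInstance
  letI : Algebra (ZMod p) k₀ := ZMod.algebra k₀ p
  -- Frobenius-fixed elements of `k₀` come from `𝔽_p`
  have hfix : ∀ c : k₀, c ^ p = c → κ₂ c = κ₁ c := by
    intro c hc
    obtain ⟨m, rfl⟩ := exists_eq_cast_of_pow_char_eq p (algebraMap (ZMod p) k₀) hc
    rw [← RingHom.comp_apply, ← RingHom.comp_apply]
    congr 1
    exact Subsingleton.elim _ _
  -- a generator `g` of `k₀ˣ`, with `g^p ≠ g`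
  obtain ⟨g, hg⟩ := IsCyclic.exists_generator (α := k₀ˣ)
  have hord : orderOf g = p ^ 2 - 1 := by
    rw [orderOf_eq_card_of_forall_mem_zpowers hg, Nat.card_eq_fintype_card, Fintype.card_units, hcard]
  have hgp : (g : k₀) ^ p ≠ g := by
    intro h
    have h1 : g ^ (p - 1) = 1 := by
      apply Units.ext
      have h2 : (g : k₀) ^ (p - 1) * g = g := by
        rw [← pow_succ, Nat.sub_add_cancel hp1.le, h]
      rw [Units.val_pow_eq_pow_val, Units.val_one]
      exact mul_right_cancel₀ (Units.ne_zero g) (by rw [h2, one_mul])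
    have h3 : orderOf g ∣ p - 1 := orderOf_dvd_of_pow_eq_one h1
    rw [hord] at h3
    have h4 : p ^ 2 - 1 ≤ p - 1 := Nat.le_of_dvd (by omega) h3
    have h5 : p < p ^ 2 := by nlinarith
    omega
  -- `s = g + g^p`, `n = g^{p+1}` are Frobenius-fixed
  have hgpp : (g : k₀) ^ p ^ 2 = g := by rw [← hcard]; exact FiniteField.pow_card _
  have hs : ((g : k₀) + (g : k₀) ^ p) ^ p = (g : k₀) + (g : k₀) ^ p := by
    rw [add_pow_char, ← pow_mul, ← sq, hgpp, add_comm]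
  have hn : ((g : k₀) ^ (p + 1)) ^ p = (g : k₀) ^ (p + 1) := by
    rw [← pow_mul, show (p + 1) * p = p ^ 2 + p from by ring, pow_add, hgpp, pow_succ']
  -- the quadratic relation, pushed along `κ₂` and `κ₁`
  set a : L := κ₁ g with ha
  set c : L := κ₂ g with hc
  have hrel : (g : k₀) ^ 2 - ((g : k₀) + (g : k₀) ^ p) * g + (g : k₀) ^ (p + 1) = 0 := by ring
  have hc_root : c ^ 2 - κ₁ ((g : k₀) + (g : k₀) ^ p) * c + κ₁ ((g : k₀) ^ (p + 1)) = 0 := by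
    rw [← hfix _ hs, ← hfix _ hn, hc]
    have := congrArg κ₂ hrel
    simpa [map_sub, map_add, map_mul, map_pow] using this
  have hfactor : (c - a) * (c - a ^ p) = 0 := by
    rw [← hc_root, map_add, map_pow, map_pow, ha]; ring
  -- hence `κ₂ g = κ₁ g` or `κ₂ g = (κ₁ g)^p`, and powers of `g` exhaust `k₀`
  have key : ∀ x : k₀, x ≠ 0 → ∃ m : ℕ, x = (g : k₀) ^ m := by
    intro x hx
    have hx' : Units.mk0 x hx ∈ Submonoid.powers g := (mem_powers_iff_mem_zpowers).mpr (hg _)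
    obtain ⟨m, hm⟩ := (Submonoid.mem_powers_iff _ _).mp hx'
    exact ⟨m, by rw [← Units.val_pow_eq_pow_val, hm, Units.val_mk0]⟩
  rcases mul_eq_zero.mp hfactor with h | h
  · left
    have hcg : κ₂ (g : k₀) = κ₁ g := sub_eq_zero.mp h
    refine RingHom.ext fun x => ?_
    by_cases hx : x = 0
    · rw [hx, map_zero, map_zero]
    · obtain ⟨m, rfl⟩ := key x hx
      rw [map_pow, map_pow, hcg]
  · right
    have hcg : κ₂ (g : k₀) = κ₁ g ^ p := sub_eq_zero.mp h
    intro x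
    by_cases hx : x = 0
    · rw [hx, map_zero, map_zero, zero_pow hp.out.ne_zero]
    · obtain ⟨m, rfl⟩ := key x hx
      rw [map_pow, map_pow, hcg, ← pow_mul, ← pow_mul, mul_comm]

end Summit.BirchSwinnertonDyer.BirchSwinnertonDyer.Theorems.SmallImageLambdaLowerThreeNsThetaPartner
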